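/-
Copyright (c) 2026 the pub-hodgecm-mathlib formalisation cell (harness21).  Prover seat hodgecm-mathlib-LH4-p19 (g2), req620 Track A «(D-RAM) FOUR-FRAME» squad
(STAGE-1b, row (2) of the piece `f_{T₊}`, the (β₂) road (R-36) «PURE-CELL LEDGER»; β₂ sub-dealer LH4-p04 lineage, lane B (RamK), row (L-D♭) «the diagonal cell below the
clean line» — the COUNT, E-side digits), 2026-09-04.
-/
import Summits.HodgeConjecture.HodgeConjecture.Theorems.F0P3cDyRamCellBalanceOfFibreHalving   -- ★ p862250+p862268 (LH4-p19 (g0)): the abstract half (`card_filter_filter_eq_of_fibre_halving`, `card_filter_eq_card_filter_not_of_fibre_const`)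
import Literature.NumberTheory.LocalFields.WildQuadraticDatumNormSignConductor               -- ★ (LH4-p06 (g3)): `normSign_eq_of_near`, `sum_normSign_repr_eq_zero`; brings ★ `normSign`, `IsRamifiedQuadraticDatum`
import Literature.NumberTheory.LocalFields.WildQuadraticDatumTrace                           -- ★ `v_varpi_pow`
import Summits.HodgeConjecture.HodgeConjecture.Theorems.F0P3cDyRamNormPairsIffFrames           -- ★ `normSign_eq_one_or` (reused, not restated)
import HarnessLib

/-!
# Crux `H413`, line LH4 «(D-RAM) FOUR-FRAME» — STAGE-1b, row (2), the (β₂) road (R-36), lane B, row (L-D♭), THE COUNT — E-SIDE DIGITS: «AN AFFINE LABEL `ω(α₁ + γ₁V)` OF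
# CONDUCTOR DEPTH `g` IS BALANCED ON EVERY DIGIT SYSTEM WHOSE LITERAL HALVES THE TAIL-DIGIT ORBITS» (`1 ≤ g ≤ d − 1`; Serre V §3 Cor. 3 in representative currency)

Cell `hodgecm-mathlib` (D-0151), FLOOR 0, crux item H413 = `stmt-HodgeConjecture-24833`, route of record `HCCMUnconditional`; squad F0∕P3c∕LH4; lane
`--supports stmt-HodgeConjecture-24833 --as helper` (count-neutral; pays NO tier-0 row).  THEOREMS ONLY (no `def`, no instance, no notation, no `sorry`, default heartbeats);
★-only imports; states NO law; (β₂) stays a HYPOTHESIS.  DATUM-FREE E-side algebra: one valued field `K` with the sheet datum `IsRamifiedQuadraticDatum σ ϖ d t` (the fixed field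
`F = K^σ` is never a type: «`V ∈ 𝒪_F ∕ 𝔭_F^n`» is spelled by a finite COMPLETE IRREDUNDANT SYSTEM OF REPRESENTATIVES `R ⊆ {σV = V, |V| ≤ 1}` for the relation
`|V − V′| ≤ |ϖ|^{2n}`, exactly as in ★ `sum_normSign_repr_eq_zero`), the norm-class sign `ω = normSign σ`.

WHY (memo `F0/P3c/LH4/LH4-p19/g0/MECH-LDflat.v1.LH4p19g0.md` 8f57960d §2–§3; this seat's ★ `F0P3cDyRamDiagonalCellLetterBalanced` ∕ ★-filed `…ScalarUnit` give the per-vertex half).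
On the diagonal cell `D` of the (β₂) ledger, in the (T, V)-coordinates of the letter scalar, the three dictionaries read: POPULATED ⟺ `ω(T) = p`, LABEL ⟺ `ω(T)·ω(α₁ + γ₁V) = +`
(`|α₁| = 1`, `|γ₁| = |ϖ|^{2g}` with `2g = δ` the eigenvalue gap), LITERAL = a predicate of `V` alone which holds on EXACTLY HALF of every tail-digit orbit `V₀ + 𝔭_F^{d−g}`
(K♮-side, sibling file).  So `cellDiff(D) = 0` in the balanced regime `1 ≤ g ≤ d − 1` is the following DIGIT COUNT, proved here from ★ `sum_normSign_repr_eq_zero` (conductor of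
`ω` is `d`: `ω` is non-trivial on `U_F^{(d−1)}`, trivial on `U_F^{(d)}`) and this seat's ★ abstract half:
* §1 `sum_normSign_affine_repr_eq_zero`, `card_filter_affine_plus_eq_card_filter_affine_minus` — THE BASE BALANCE: over a digit system `R` of `𝒪_F ∕ 𝔭_F^{d−g}`,
  `Σ_{V ∈ R} ω(α₁ + γ₁V) = 0` (the set `{α₁ + γ₁V}` = `α₁·U_F^{(g)}` is `U_F^{(d−1)}`-stable since `g ≤ d − 1`, and `R ↦ α₁ + γ₁R` represents it modulo `𝔭^{2d}`).
* §2 `card_filter_near_eq_card_filter_near` — digit systems have UNIFORM FIBRES: `#{V ∈ R_n ∣ V ≡ V₀ (𝔭_F^k)} = #{V ∈ R_n ∣ V ≡ V₁ (𝔭_F^k)}` (`k ≤ n`; translate and re-represent).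
* §3 HEAD `card_filter_lit_plus_eq_card_filter_lit_minus` — for digit systems `R_d` (mod `𝔭_F^d`), `R′` (mod `𝔭_F^{d−g}`) and ANY literal predicate `LIT` on `K` with the
  HALVING property `2·#{V ∈ R_d ∣ LIT V ∧ V ≡ V₀} = #{V ∈ R_d ∣ V ≡ V₀}` for every `V₀ ∈ R′`:
  `#{V ∈ R_d ∣ LIT V ∧ ω(α₁ + γ₁V) = 1} = #{V ∈ R_d ∣ LIT V ∧ ω(α₁ + γ₁V) = −1}` (★ `card_filter_filter_eq_of_fibre_halving` with `π` = «the `R′`-digit of `V`», `ψ` = the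
  affine label, base balance §1, uniform fibres §2 via ★ `card_filter_eq_card_filter_not_of_fibre_const`).
WHAT IS NOT CLAIMED: the K♮-side halving (sibling), the (T, V)-coordinates and the lattice fibration (this seat's K3–K5), the identification of the populated ∕ label predicates.
HONEST LABEL.  Count-neutral finite counting over norm classes; nothing printed is asserted; no census law is stated; `HC_CM` is proved only modulo the 7 printed citations
(2 remaining named inputs: hLiu418 = `stmt-HodgeConjecture-24832`, h413 = `stmt-HodgeConjecture-24833`) until rung 0 closes.
## References
* [Serre1979] J.-P. Serre, *Local Fields*, GTM 67 (1979): Ch. V §3 Prop. 5, Cor. 3 pp. 85–87 (conductor of a ramified quadratic extension), Ch. XV §2 (norm residue symbol on `U^{(n)}`).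
* [Kottwitz1986BaseChangeUnits] R. E. Kottwitz, *Base change for unit elements of Hecke algebras*, Compositio Math. 60 (1986): §1 pp. 240–241 (fixed-lattice counts as orbital integrals).
* [Rogawski1990] J. D. Rogawski, *Automorphic Representations of Unitary Groups in Three Variables*, Ann. of Math. Stud. 123 (1990): §4.9 Prop. 4.9.1 (b) p. 55, §12.2 (κ-signed counts).
* [LabesseLanglands1979] J.-P. Labesse, R. P. Langlands, *L-indistinguishability for SL(2)*, Canad. J. Math. 31 (1979): §2 (2.2) p. 9 (a ramified character sums to zero on deep shells).
-/

set_option autoImplicit false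

noncomputable section

namespace Summit.HodgeConjecture.HodgeConjecture.Cruxes.H413.F0P3cDyRamDiagonalCellLabelDigits

open scoped Valued WithZero
open WithZero Finset
open Literature.NumberTheory.Automorphic.UnitaryThreeFourFrame (IsRamifiedQuadraticDatum normSign normSign_of_isNorm normSign_of_not_isNorm)
open Literature.NumberTheory.LocalFields.WildQuadraticDatum (v_varpi_pow normSign_eq_of_near sum_normSign_repr_eq_zero)
open Summit.HodgeConjecture.HodgeConjecture.Cruxes.H413.F0P3cDyRamCellBalanceOfFibreHalving (card_filter_filter_eq_of_fibre_halving card_filter_eq_card_filter_not_of_fibre_const)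
open Summit.HodgeConjecture.HodgeConjecture.Cruxes.H413.F0P3cDyRamNormPairsIffFrames (normSign_eq_one_or)

variable {K : Type} [Field K] [Valued K ℤᵐ⁰] {σ : K →+* K} {ϖ : K} {d t : ℕ}

/-! ## §0 Small letters -/

omit [Valued K ℤᵐ⁰] in
/-- `Σ_{S} ω = #{ω = 1} − #{ω = −1}` (as integers). [cite: Serre1979, Ch. XV §2] -/
theorem sum_normSign_eq_card_sub_card (σ : K →+* K) (S : Finset K) (φ : K → K) :
    ∑ V ∈ S, normSign σ (φ V) = ((S.filter fun V => normSign σ (φ V) = 1).card : ℤ) - ((S.filter fun V => normSign σ (φ V) = -1).card : ℤ) := by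
  classical
  rw [← sum_filter_add_sum_filter_not S (fun V => normSign σ (φ V) = 1)]
  have h1 : ∑ V ∈ S.filter (fun V => normSign σ (φ V) = 1), normSign σ (φ V) = ((S.filter fun V => normSign σ (φ V) = 1).card : ℤ) := by
    rw [card_eq_sum_ones, Nat.cast_sum, Nat.cast_one]
    exact sum_congr rfl fun V hV => (mem_filter.1 hV).2
  have hfilt : (S.filter fun V => ¬ normSign σ (φ V) = 1) = S.filter fun V => normSign σ (φ V) = -1 := by
    refine filter_congr fun V _ => ?_
    rcases normSign_eq_one_or σ (φ V) with h | h
    · rw [h]; norm_num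
    · rw [h]; norm_num
  have h2 : ∑ V ∈ S.filter (fun V => ¬ normSign σ (φ V) = 1), normSign σ (φ V) = -((S.filter fun V => normSign σ (φ V) = -1).card : ℤ) := by
    rw [hfilt, card_eq_sum_ones, Nat.cast_sum, Nat.cast_one, ← sum_neg_distrib]
    exact sum_congr rfl fun V hV => (mem_filter.1 hV).2
  rw [h1, h2]
  ring

/-! ## §1 THE BASE BALANCE: an affine label of conductor depth `g ≤ d − 1` sums to zero over a digit system of `𝒪_F ∕ 𝔭_F^{d−g}` -/

/-- **`Σ_{V ∈ R} ω(α₁ + γ₁V) = 0`.**  At a complete sheet datum with finite residue field and `|2| < 1`: for `σ`-fixed `α₁, γ₁` with `|α₁| = 1`, `|γ₁| = |ϖ|^{2g}`, `1 ≤ g`,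
`g + 1 ≤ d`, and a COMPLETE IRREDUNDANT system `R` of `σ`-fixed integers modulo `|·| ≤ |ϖ|^{2(d−g)}` (the digits of `𝒪_F ∕ 𝔭_F^{d−g}`), the norm-class signs of the affine
label cancel: the set `A = {α₁ + γ₁V ∣ σV = V, |V| ≤ 1} = α₁·U_F^{(g)}` is stable under `U_F^{(d−1)}` (`a(α₁ + γ₁V) = α₁ + γ₁(aV + α₁(a − 1)∕γ₁)`, integral since `g ≤ d − 1`)
and `V ↦ α₁ + γ₁V` turns `R` into a complete irredundant system for `A` modulo `𝔭^{2d}`, so ★ `sum_normSign_repr_eq_zero` applies.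
[cite: Serre1979, Ch. V §3 Prop. 5, Cor. 3 pp. 85–87] [cite: Serre1979, Ch. XV §2] [cite: LabesseLanglands1979, §2 (2.2) p. 9] -/
theorem sum_normSign_affine_repr_eq_zero [CompleteSpace K] [Finite 𝓀[K]] (hD : IsRamifiedQuadraticDatum σ ϖ d t) (h2v : Valued.v (2 : K) < 1)
    {α₁ γ₁ : K} (hσα : σ α₁ = α₁) (hα1 : Valued.v α₁ = 1) (hσγ : σ γ₁ = γ₁) {g : ℕ} (hγ : Valued.v γ₁ = Valued.v ϖ ^ (2 * g)) (hg1 : 1 ≤ g) (hgd : g + 1 ≤ d)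
    (R : Finset K) (hR1 : ∀ V ∈ R, σ V = V ∧ Valued.v V ≤ 1)
    (hR2 : ∀ V : K, σ V = V → Valued.v V ≤ 1 → ∃ V₀ ∈ R, Valued.v (V - V₀) ≤ Valued.v ϖ ^ (2 * (d - g)))
    (hR3 : ∀ V ∈ R, ∀ V' ∈ R, Valued.v (V - V') ≤ Valued.v ϖ ^ (2 * (d - g)) → V = V') :
    ∑ V ∈ R, normSign σ (α₁ + γ₁ * V) = 0 := by
  classical
  obtain ⟨hσσ, hvσ, hϖ, hfix, hdd, hd1, ht⟩ := hD
  have hvϖ0 : Valued.v ϖ ≠ 0 := by rw [hϖ]; exact exp_ne_zero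
  have hϖ1 : Valued.v ϖ ≤ 1 := by rw [hϖ, ← exp_zero, exp_le_exp]; norm_num
  have hϖlt : Valued.v ϖ < 1 := by rw [hϖ, ← exp_zero, exp_lt_exp]; norm_num
  have hγ0 : γ₁ ≠ 0 := fun h0 => by rw [h0, map_zero] at hγ; exact pow_ne_zero _ hvϖ0 hγ.symm
  have hγlt : Valued.v γ₁ < 1 := by rw [hγ]; exact pow_lt_one₀ zero_le hϖlt (by omega)
  -- the label is a unit: `|α₁ + γ₁V| = 1`
  have hunit : ∀ V : K, Valued.v V ≤ 1 → Valued.v (α₁ + γ₁ * V) = 1 := by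
    intro V hV
    have hlt : Valued.v (γ₁ * V) < Valued.v α₁ := by
      rw [hα1, Valuation.map_mul]
      calc Valued.v γ₁ * Valued.v V ≤ Valued.v γ₁ * 1 := by gcongr
        _ < 1 := by rw [mul_one]; exact hγlt
    rw [Valuation.map_add_eq_of_lt_left _ hlt, hα1]
  -- the set `A` and its `U_F^{(d−1)}`-stability
  set A : Set K := {f | ∃ V : K, σ V = V ∧ Valued.v V ≤ 1 ∧ f = α₁ + γ₁ * V} with hA
  have hAmem : ∀ f ∈ A, σ f = f ∧ Valued.v f = 1 := by
    rintro f ⟨V, hσV, hV, rfl⟩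
    exact ⟨by rw [map_add, map_mul, hσα, hσγ, hσV], hunit V hV⟩
  have hAst : ∀ f ∈ A, ∀ a : K, σ a = a → Valued.v a = 1 → Valued.v (a - 1) ≤ exp (-(2 * ((d - 1 : ℕ) : ℤ))) → a * f ∈ A := by
    rintro f ⟨V, hσV, hV, rfl⟩ a hσa ha1 had
    refine ⟨a * V + α₁ * (a - 1) / γ₁, by rw [map_add, map_mul, map_div₀, map_mul, map_sub, map_one, hσa, hσV, hσα, hσγ], ?_, by field_simp; ring⟩
    refine (Valuation.map_add _ _ _).trans (max_le ?_ ?_)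
    · rw [Valuation.map_mul, ha1, one_mul]; exact hV
    · rw [map_div₀, Valuation.map_mul, hα1, one_mul, hγ, div_le_one₀ (zero_lt_iff.2 (pow_ne_zero _ hvϖ0))]
      refine had.trans ?_
      rw [v_varpi_pow hϖ, exp_le_exp]
      push_cast
      omega
  -- the representative system `S = α₁ + γ₁ R`
  have hinj : Set.InjOn (fun V => α₁ + γ₁ * V) R := by
    intro V hV V' hV' h
    have : γ₁ * V = γ₁ * V' := by simpa using h
    exact mul_left_cancel₀ hγ0 this
  have hS1 : ∀ f ∈ R.image (fun V => α₁ + γ₁ * V), f ∈ A := by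
    intro f hf
    obtain ⟨V, hV, rfl⟩ := mem_image.1 hf
    exact ⟨V, (hR1 V hV).1, (hR1 V hV).2, rfl⟩
  have hS2 : ∀ f ∈ A, ∃ f₀ ∈ R.image (fun V => α₁ + γ₁ * V), Valued.v (f - f₀) ≤ Valued.v ϖ ^ (2 * d) := by
    rintro f ⟨V, hσV, hV, rfl⟩
    obtain ⟨V₀, hV₀, hVV₀⟩ := hR2 V hσV hV
    refine ⟨α₁ + γ₁ * V₀, mem_image.2 ⟨V₀, hV₀, rfl⟩, ?_⟩
    have e : α₁ + γ₁ * V - (α₁ + γ₁ * V₀) = γ₁ * (V - V₀) := by ring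
    rw [e, Valuation.map_mul, hγ]
    calc Valued.v ϖ ^ (2 * g) * Valued.v (V - V₀) ≤ Valued.v ϖ ^ (2 * g) * Valued.v ϖ ^ (2 * (d - g)) := by gcongr
      _ = Valued.v ϖ ^ (2 * d) := by rw [← pow_add]; congr 1; omega
  have hS3 : ∀ f ∈ R.image (fun V => α₁ + γ₁ * V), ∀ f' ∈ R.image (fun V => α₁ + γ₁ * V), Valued.v (f - f') ≤ Valued.v ϖ ^ (2 * d) → f = f' := by
    intro f hf f' hf' hff'
    obtain ⟨V, hV, rfl⟩ := mem_image.1 hf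
    obtain ⟨V', hV', rfl⟩ := mem_image.1 hf'
    have e : α₁ + γ₁ * V - (α₁ + γ₁ * V') = γ₁ * (V - V') := by ring
    rw [e, Valuation.map_mul, hγ] at hff'
    have h2 : Valued.v (V - V') ≤ Valued.v ϖ ^ (2 * (d - g)) := by
      have hsplit : Valued.v ϖ ^ (2 * d) = Valued.v ϖ ^ (2 * g) * Valued.v ϖ ^ (2 * (d - g)) := by rw [← pow_add]; congr 1; omega
      rw [hsplit] at hff'
      exact le_of_mul_le_mul_left hff' (zero_lt_iff.2 (pow_ne_zero _ hvϖ0))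
    rw [hR3 V hV V' hV' h2]
  have hsum := sum_normSign_repr_eq_zero ⟨hσσ, hvσ, hϖ, hfix, hdd, hd1, ht⟩ h2v (ρ := 2 * d) (by omega) hAmem hAst (R.image fun V => α₁ + γ₁ * V) hS1 hS2 hS3
  rwa [sum_image hinj] at hsum

/-- **THE BASE BALANCE AS A COUNT**: `#{V ∈ R ∣ ω(α₁ + γ₁V) = 1} = #{V ∈ R ∣ ¬ ω(α₁ + γ₁V) = 1}` (letters of `sum_normSign_affine_repr_eq_zero`).
[cite: Serre1979, Ch. V §3 Cor. 3 pp. 85–87] [cite: Serre1979, Ch. XV §2] -/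
theorem card_filter_affine_plus_eq_card_filter_not [CompleteSpace K] [Finite 𝓀[K]] (hD : IsRamifiedQuadraticDatum σ ϖ d t) (h2v : Valued.v (2 : K) < 1)
    {α₁ γ₁ : K} (hσα : σ α₁ = α₁) (hα1 : Valued.v α₁ = 1) (hσγ : σ γ₁ = γ₁) {g : ℕ} (hγ : Valued.v γ₁ = Valued.v ϖ ^ (2 * g)) (hg1 : 1 ≤ g) (hgd : g + 1 ≤ d)
    (R : Finset K) (hR1 : ∀ V ∈ R, σ V = V ∧ Valued.v V ≤ 1)
    (hR2 : ∀ V : K, σ V = V → Valued.v V ≤ 1 → ∃ V₀ ∈ R, Valued.v (V - V₀) ≤ Valued.v ϖ ^ (2 * (d - g)))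
    (hR3 : ∀ V ∈ R, ∀ V' ∈ R, Valued.v (V - V') ≤ Valued.v ϖ ^ (2 * (d - g)) → V = V') :
    (R.filter fun V => normSign σ (α₁ + γ₁ * V) = 1).card = (R.filter fun V => ¬ normSign σ (α₁ + γ₁ * V) = 1).card := by
  classical
  have hsum := sum_normSign_affine_repr_eq_zero hD h2v hσα hα1 hσγ hγ hg1 hgd R hR1 hR2 hR3
  rw [sum_normSign_eq_card_sub_card σ R (fun V => α₁ + γ₁ * V)] at hsum
  have hfilt : (R.filter fun V => ¬ normSign σ (α₁ + γ₁ * V) = 1) = R.filter fun V => normSign σ (α₁ + γ₁ * V) = -1 := by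
    refine filter_congr fun V _ => ?_
    rcases normSign_eq_one_or σ (α₁ + γ₁ * V) with h | h
    · rw [h]; norm_num
    · rw [h]; norm_num
  rw [hfilt]
  omega

/-! ## §2 Digit systems have UNIFORM FIBRES over coarser digits -/

/-- **TRANSLATION OF A DIGIT SYSTEM**: for a complete irredundant system `R` of `σ`-fixed integers modulo `|·| ≤ |ϖ|^{2n}` and `σ`-fixed integers `V₀, V₁`, the sub-systems
`{V ∈ R ∣ |V − V₀| ≤ |ϖ|^{2k}}` and `{V ∈ R ∣ |V − V₁| ≤ |ϖ|^{2k}}` (`k ≤ n`) have the same size: `V ↦ rep(V − V₀ + V₁)` injects the first into the second (`|ϖ| ≤ 1`).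
[cite: Serre1979, Ch. XV §2] [cite: Kottwitz1986BaseChangeUnits, §1 pp. 240–241] -/
theorem card_filter_near_le_card_filter_near (hϖ1 : Valued.v ϖ ≤ 1) {n k : ℕ} (hkn : k ≤ n)
    (R : Finset K) (hR1 : ∀ V ∈ R, σ V = V ∧ Valued.v V ≤ 1)
    (hR2 : ∀ V : K, σ V = V → Valued.v V ≤ 1 → ∃ V' ∈ R, Valued.v (V - V') ≤ Valued.v ϖ ^ (2 * n))
    (hR3 : ∀ V ∈ R, ∀ V' ∈ R, Valued.v (V - V') ≤ Valued.v ϖ ^ (2 * n) → V = V')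
    {V₀ V₁ : K} (hσV₀ : σ V₀ = V₀) (hV₀ : Valued.v V₀ ≤ 1) (hσV₁ : σ V₁ = V₁) (hV₁ : Valued.v V₁ ≤ 1) :
    (R.filter fun V => Valued.v (V - V₀) ≤ Valued.v ϖ ^ (2 * k)).card ≤ (R.filter fun V => Valued.v (V - V₁) ≤ Valued.v ϖ ^ (2 * k)).card := by
  classical
  have hkn' : Valued.v ϖ ^ (2 * n) ≤ Valued.v ϖ ^ (2 * k) := pow_le_pow_right_of_le_one' hϖ1 (by omega)
  -- the re-representation map
  have hrep : ∀ V ∈ R, ∃ V' ∈ R, Valued.v (V - V₀ + V₁ - V') ≤ Valued.v ϖ ^ (2 * n) := by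
    intro V hV
    obtain ⟨hσV, hvV⟩ := hR1 V hV
    exact hR2 (V - V₀ + V₁) (by rw [map_add, map_sub, hσV, hσV₀, hσV₁])
      ((Valuation.map_add _ _ _).trans (max_le ((Valuation.map_sub _ _ _).trans (max_le hvV hV₀)) hV₁))
  choose! φ hφR hφ using hrep
  refine card_le_card_of_injOn φ (fun V hV => ?_) ?_
  · rw [mem_coe, mem_filter] at hV ⊢
    refine ⟨hφR V hV.1, ?_⟩
    have e : φ V - V₁ = (V - V₀) - (V - V₀ + V₁ - φ V) := by ring
    rw [e]
    exact (Valuation.map_sub _ _ _).trans (max_le hV.2 ((hφ V hV.1).trans hkn'))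
  · intro V hV V' hV' hVV'
    rw [mem_coe, mem_filter] at hV hV'
    apply hR3 V hV.1 V' hV'.1
    have e : V - V' = (V - V₀ + V₁ - φ V) - (V' - V₀ + V₁ - φ V') + (φ V - φ V') := by ring
    rw [e]
    refine (Valuation.map_add _ _ _).trans (max_le ((Valuation.map_sub _ _ _).trans (max_le (hφ V hV.1) (hφ V' hV'.1))) ?_)
    rw [hVV', sub_self, Valuation.map_zero]
    exact zero_le

/-- **UNIFORM FIBRES**: the two sub-systems of `card_filter_near_le_card_filter_near` have EQUAL size. [cite: Serre1979, Ch. XV §2] -/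
theorem card_filter_near_eq_card_filter_near (hϖ1 : Valued.v ϖ ≤ 1) {n k : ℕ} (hkn : k ≤ n)
    (R : Finset K) (hR1 : ∀ V ∈ R, σ V = V ∧ Valued.v V ≤ 1)
    (hR2 : ∀ V : K, σ V = V → Valued.v V ≤ 1 → ∃ V' ∈ R, Valued.v (V - V') ≤ Valued.v ϖ ^ (2 * n))
    (hR3 : ∀ V ∈ R, ∀ V' ∈ R, Valued.v (V - V') ≤ Valued.v ϖ ^ (2 * n) → V = V')
    {V₀ V₁ : K} (hσV₀ : σ V₀ = V₀) (hV₀ : Valued.v V₀ ≤ 1) (hσV₁ : σ V₁ = V₁) (hV₁ : Valued.v V₁ ≤ 1) :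
    (R.filter fun V => Valued.v (V - V₀) ≤ Valued.v ϖ ^ (2 * k)).card = (R.filter fun V => Valued.v (V - V₁) ≤ Valued.v ϖ ^ (2 * k)).card :=
  le_antisymm (card_filter_near_le_card_filter_near hϖ1 hkn R hR1 hR2 hR3 hσV₀ hV₀ hσV₁ hV₁)
    (card_filter_near_le_card_filter_near hϖ1 hkn R hR1 hR2 hR3 hσV₁ hV₁ hσV₀ hV₀)

/-! ## §3 HEAD — an affine label is balanced on the literal part of the fine digits when the literal halves every tail-digit orbit -/

/-- **HEAD — «THE AFFINE LABEL IS BALANCED ON THE LITERAL HALF» (the E-side count of (L-D♭)).**  At a complete sheet datum with finite residue field and `|2| < 1`: `σ`-fixed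
`α₁, γ₁` with `|α₁| = 1`, `|γ₁| = |ϖ|^{2g}`, `1 ≤ g`, `g + 1 ≤ d`; digit systems `R_d` (fixed integers modulo `|·| ≤ |ϖ|^{2d}`) and `R′` (modulo `|·| ≤ |ϖ|^{2(d−g)}`); a
literal predicate `LIT` with the HALVING PROPERTY on `R_d` over every coarse digit: `2·#{V ∈ R_d ∣ LIT V ∧ |V − V₀| ≤ |ϖ|^{2(d−g)}} = #{V ∈ R_d ∣ |V − V₀| ≤ |ϖ|^{2(d−g)}}`
(`V₀ ∈ R′`).  THEN `#{V ∈ R_d ∣ LIT V ∧ ω(α₁ + γ₁V) = 1} = #{V ∈ R_d ∣ LIT V ∧ ¬ ω(α₁ + γ₁V) = 1}`: the label `ω(α₁ + γ₁V)` only depends on the coarse digit of `V`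
(`γ₁·𝔭_F^{d−g} ⊆ 𝔭_F^d`, ★ `normSign_eq_of_near`), is balanced over `R′` (§1) hence over `R_d` (uniform fibres §2, ★ `card_filter_eq_card_filter_not_of_fibre_const`), and the
literal halves every fibre — ★ `card_filter_filter_eq_of_fibre_halving`. [cite: Serre1979, Ch. V §3 Cor. 3 pp. 85–87] [cite: Kottwitz1986BaseChangeUnits, §1 pp. 240–241]
[cite: Rogawski1990, §4.9 Prop. 4.9.1 (b) p. 55] [cite: LabesseLanglands1979, §2 (2.2) p. 9] -/
theorem card_filter_lit_plus_eq_card_filter_lit_not [CompleteSpace K] [Finite 𝓀[K]] (hD : IsRamifiedQuadraticDatum σ ϖ d t) (h2v : Valued.v (2 : K) < 1)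
    {α₁ γ₁ : K} (hσα : σ α₁ = α₁) (hα1 : Valued.v α₁ = 1) (hσγ : σ γ₁ = γ₁) {g : ℕ} (hγ : Valued.v γ₁ = Valued.v ϖ ^ (2 * g)) (hg1 : 1 ≤ g) (hgd : g + 1 ≤ d)
    (Rd : Finset K) (hRd1 : ∀ V ∈ Rd, σ V = V ∧ Valued.v V ≤ 1)
    (hRd2 : ∀ V : K, σ V = V → Valued.v V ≤ 1 → ∃ V₀ ∈ Rd, Valued.v (V - V₀) ≤ Valued.v ϖ ^ (2 * d))
    (hRd3 : ∀ V ∈ Rd, ∀ V' ∈ Rd, Valued.v (V - V') ≤ Valued.v ϖ ^ (2 * d) → V = V')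
    (R' : Finset K) (hR'1 : ∀ V ∈ R', σ V = V ∧ Valued.v V ≤ 1)
    (hR'2 : ∀ V : K, σ V = V → Valued.v V ≤ 1 → ∃ V₀ ∈ R', Valued.v (V - V₀) ≤ Valued.v ϖ ^ (2 * (d - g)))
    (hR'3 : ∀ V ∈ R', ∀ V' ∈ R', Valued.v (V - V') ≤ Valued.v ϖ ^ (2 * (d - g)) → V = V')
    (LIT : K → Prop) [DecidablePred LIT]
    (hhalf : ∀ V₀ ∈ R', 2 * ((Rd.filter LIT).filter fun V => Valued.v (V - V₀) ≤ Valued.v ϖ ^ (2 * (d - g))).card =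
      (Rd.filter fun V => Valued.v (V - V₀) ≤ Valued.v ϖ ^ (2 * (d - g))).card) :
    ((Rd.filter LIT).filter fun V => normSign σ (α₁ + γ₁ * V) = 1).card = ((Rd.filter LIT).filter fun V => ¬ normSign σ (α₁ + γ₁ * V) = 1).card := by
  classical
  have hσσ := hD.1
  have hϖ := hD.2.2.1
  have hvϖ0 : Valued.v ϖ ≠ 0 := by rw [hϖ]; exact exp_ne_zero
  have hϖ1 : Valued.v ϖ ≤ 1 := by rw [hϖ, ← exp_zero, exp_le_exp]; norm_num
  have hϖlt : Valued.v ϖ < 1 := by rw [hϖ, ← exp_zero, exp_lt_exp]; norm_num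
  have hγlt : Valued.v γ₁ < 1 := by rw [hγ]; exact pow_lt_one₀ zero_le hϖlt (by omega)
  have hunit : ∀ V : K, Valued.v V ≤ 1 → Valued.v (α₁ + γ₁ * V) = 1 := by
    intro V hV
    have hlt : Valued.v (γ₁ * V) < Valued.v α₁ := by
      rw [hα1, Valuation.map_mul]
      calc Valued.v γ₁ * Valued.v V ≤ Valued.v γ₁ * 1 := by gcongr
        _ < 1 := by rw [mul_one]; exact hγlt
    rw [Valuation.map_add_eq_of_lt_left _ hlt, hα1]
  -- the coarse-digit map `π` (choice of the `R′`-representative; identity off the fixed integers)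
  have hrep : ∀ V : K, ∃ V₀ : K, (σ V = V ∧ Valued.v V ≤ 1) → V₀ ∈ R' ∧ Valued.v (V - V₀) ≤ Valued.v ϖ ^ (2 * (d - g)) := by
    intro V
    by_cases h : σ V = V ∧ Valued.v V ≤ 1
    · obtain ⟨V₀, hV₀, hVV₀⟩ := hR'2 V h.1 h.2
      exact ⟨V₀, fun _ => ⟨hV₀, hVV₀⟩⟩
    · exact ⟨0, fun h' => absurd h' h⟩
  choose π hπ using hrep
  have hπR : ∀ V ∈ Rd, π V ∈ R' := fun V hV => (hπ V (hRd1 V hV)).1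
  have hπnear : ∀ V ∈ Rd, Valued.v (V - π V) ≤ Valued.v ϖ ^ (2 * (d - g)) := fun V hV => (hπ V (hRd1 V hV)).2
  -- the fibres of `π` are the near-sets
  have hfib : ∀ V₀ ∈ R', ∀ V ∈ Rd, (π V = V₀ ↔ Valued.v (V - V₀) ≤ Valued.v ϖ ^ (2 * (d - g))) := by
    intro V₀ hV₀ V hV
    constructor
    · rintro rfl; exact hπnear V hV
    · intro hnear
      apply hR'3 (π V) (hπR V hV) V₀ hV₀
      have e : π V - V₀ = (V - V₀) - (V - π V) := by ring
      rw [e]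
      exact (Valuation.map_sub _ _ _).trans (max_le hnear (hπnear V hV))
  have hfibset : ∀ V₀ ∈ R', ∀ (T : Finset K), T ⊆ Rd →
      (T.filter fun V => π V = V₀) = T.filter fun V => Valued.v (V - V₀) ≤ Valued.v ϖ ^ (2 * (d - g)) := by
    intro V₀ hV₀ T hT
    exact filter_congr fun V hV => hfib V₀ hV₀ V (hT hV)
  -- the label read through `π`
  set ψ : K → Prop := fun y => normSign σ (α₁ + γ₁ * y) = 1 with hψ
  have hψπ : ∀ V ∈ Rd, (ψ (π V) ↔ normSign σ (α₁ + γ₁ * V) = 1) := by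
    intro V hV
    obtain ⟨hσV, hvV⟩ := hRd1 V hV
    obtain ⟨hσV₀, hvV₀⟩ := hR'1 (π V) (hπR V hV)
    have hnear : Valued.v ((α₁ + γ₁ * V) - (α₁ + γ₁ * π V)) ≤ Valued.v ϖ ^ (2 * d) := by
      have e : α₁ + γ₁ * V - (α₁ + γ₁ * π V) = γ₁ * (V - π V) := by ring
      rw [e, Valuation.map_mul, hγ]
      calc Valued.v ϖ ^ (2 * g) * Valued.v (V - π V) ≤ Valued.v ϖ ^ (2 * g) * Valued.v ϖ ^ (2 * (d - g)) := by gcongr; exact hπnear V hV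
        _ = Valued.v ϖ ^ (2 * d) := by rw [← pow_add]; congr 1; omega
    have key := normSign_eq_of_near hD (g := α₁ + γ₁ * V) (g' := α₁ + γ₁ * π V) (by rw [map_add, map_mul, hσα, hσγ, hσV])
      (by rw [map_add, map_mul, hσα, hσγ, hσV₀]) (hunit V hvV) (n := 2 * d) (by omega) hnear
    rw [hψ]
    simp only
    rw [key]
  -- (1) halving in `π`-fibre form
  have hhalf' : ∀ y, 2 * ((Rd.filter LIT).filter fun V => π V = y).card = (Rd.filter fun V => π V = y).card := by
    intro y
    by_cases hy : y ∈ R'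
    · rw [hfibset y hy (Rd.filter LIT) (filter_subset _ _), hfibset y hy Rd (Subset.refl _)]
      exact hhalf y hy
    · have h1 : ((Rd.filter LIT).filter fun V => π V = y) = ∅ :=
        filter_eq_empty_iff.2 fun V hV h => hy (h ▸ hπR V (mem_filter.1 hV).1)
      have h2 : (Rd.filter fun V => π V = y) = ∅ := filter_eq_empty_iff.2 fun V hV h => hy (h ▸ hπR V hV)
      rw [h1, h2, card_empty]
  -- (2) the label is balanced on `Rd` through `π`: uniform fibres + base balance
  obtain ⟨y₀, hy₀, -⟩ := hR'2 0 (map_zero σ) (by rw [map_zero]; exact zero_le_one)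
  set k : ℕ := (Rd.filter fun V => Valued.v (V - y₀) ≤ Valued.v ϖ ^ (2 * (d - g))).card with hk
  have hkfib : ∀ y ∈ R', (Rd.filter fun V => π V = y).card = k := by
    intro y hy
    rw [hfibset y hy Rd (Subset.refl _), hk]
    exact card_filter_near_eq_card_filter_near hϖ1 (by omega) Rd hRd1 hRd2 hRd3 (hR'1 y hy).1 (hR'1 y hy).2 (hR'1 y₀ hy₀).1 (hR'1 y₀ hy₀).2
  have hbase : (R'.filter ψ).card = (R'.filter fun y => ¬ ψ y).card :=
    card_filter_affine_plus_eq_card_filter_not hD h2v hσα hα1 hσγ hγ hg1 hgd R' hR'1 hR'2 hR'3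
  have hbal : (Rd.filter fun V => ψ (π V)).card = (Rd.filter fun V => ¬ ψ (π V)).card :=
    card_filter_eq_card_filter_not_of_fibre_const Rd π R' hπR k hkfib ψ hbase
  -- (3) the abstract half
  have hmain := card_filter_filter_eq_of_fibre_halving Rd π LIT hhalf' ψ hbal
  -- (4) rewrite `ψ ∘ π` to the label and commute the filters
  have hL : ((Rd.filter fun V => ψ (π V)).filter LIT) = (Rd.filter LIT).filter fun V => normSign σ (α₁ + γ₁ * V) = 1 := by
    ext V
    simp only [mem_filter]
    constructor
    · rintro ⟨⟨hV, hψV⟩, hLV⟩; exact ⟨⟨hV, hLV⟩, (hψπ V hV).1 hψV⟩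
    · rintro ⟨⟨hV, hLV⟩, hψV⟩; exact ⟨⟨hV, (hψπ V hV).2 hψV⟩, hLV⟩
  have hR : ((Rd.filter fun V => ¬ ψ (π V)).filter LIT) = (Rd.filter LIT).filter fun V => ¬ normSign σ (α₁ + γ₁ * V) = 1 := by
    ext V
    simp only [mem_filter]
    constructor
    · rintro ⟨⟨hV, hψV⟩, hLV⟩; exact ⟨⟨hV, hLV⟩, fun h => hψV ((hψπ V hV).2 h)⟩
    · rintro ⟨⟨hV, hLV⟩, hψV⟩; exact ⟨⟨hV, fun h => hψV ((hψπ V hV).1 h)⟩, hLV⟩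
  rw [hL, hR] at hmain
  exact hmain

end Summit.HodgeConjecture.HodgeConjecture.Cruxes.H413.F0P3cDyRamDiagonalCellLabelDigits

end
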